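import Mathlib
import Summits.ValiantsHypothesis.ValiantsHypothesis.Theorems.FifoMatchingNNNotVPDivisionSplitDefs
import Literature.Computability.AlgebraicComplexity.NestFreeMatchingPoly
import HarnessLib

/-!
# Route FifoMatching — crux `NNNotVP` (stmt-ValiantsHypothesis-11615), line `division_split`:
# the support function of `NN_n` is nest-free perfect-matching EXISTENCE (combinatorial form)

Registered line `Cruxes/NNNotVP/Lines/division_split.lean`; objects `σ` / `NN` / `SuppFn` = the
line's vocabulary (`Theorems/FifoMatchingNNNotVPDivisionSplitDefs.lean`).

The companions restate stub A as a lower bound on `circuitSizeOver monotoneBasis` of the Boolean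
function `x ↦ [SuppFn NN_n {e | x e}]`.  For whoever builds the approximators
(`MonotoneApproximation.ApproxScheme.exists_approx_circuit` wants positive / negative test inputs),
this file spells that function out combinatorially, by name:

* `mem_support_arcExponent` — the arcs of a matching `M` are the pairs `(i, M i)` with `i < M i`;
* `suppFn_NN_iff` — `SuppFn (NN n) A` iff some nest-free perfect matching of `[2n]` has all its
  arcs in `A` (the minterms are exactly the nest-free perfect matchings);
* `nfpmExists_eq_true_iff` — the Boolean function of the `circuitSizeOver` statement, evaluated at
  an arc vector `x`, is `true` iff some nest-free perfect matching `M` has `x (i, M i) = true` for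
  all its openers `i`; `nfpmExists_arcs` — it accepts the arc vector of every nest-free perfect
  matching (the natural positive test inputs).

Honest framing: bookkeeping; the monotone lower bound, stubs Z / A / B2, the crux `NNNotVP` and
`VP ≠ VNP` stay OPEN (NOT proved).  No definitions, no named facts.
-/

noncomputable section

-- Sub = Summit single-conjunct layout: the duplicated namespace component is mandated by the tree.
set_option linter.dupNamespace false

namespace Summit.ValiantsHypothesis.ValiantsHypothesis.Theorems.FifoMatching.NNNotVP.DivisionSplit

open MvPolynomial Finset Literature.Computability.AlgebraicComplexity
open scoped NNReal BigOperators Classical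

/-- The arcs of a matching: `e` is in the support of `arcExponent M` iff `e = (i, M i)` with
`i < M i`. [folklore] -/
theorem mem_support_arcExponent {m : ℕ} (M : Fin m → Fin m) (e : Fin m × Fin m) :
    e ∈ (arcExponent M).support ↔ e.1 < M e.1 ∧ M e.1 = e.2 := by
  obtain ⟨i, j⟩ := e
  rw [Finsupp.mem_support_iff, arcExponent_apply]
  split_ifs with h
  · exact ⟨fun _ => h, fun _ => one_ne_zero⟩
  · simp [h]

/-- **The support function of `NN_n` is nest-free perfect-matching existence:** `SuppFn (NN n) A`
iff some nest-free perfect matching of `[2n]` has all its arcs `(i, M i)`, `i < M i`, in `A`.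
[folklore] -/
theorem suppFn_NN_iff (n : ℕ) (A : Finset (σ n)) :
    SuppFn (NN n) A ↔ ∃ M ∈ nestFreeMatchings (2 * n), ∀ i, i < M i → (i, M i) ∈ A := by
  unfold SuppFn
  rw [show (NN n).support = (nestFreeMatchings (2 * n)).image arcExponent from
    support_nestFreeMatchingPoly n]
  constructor
  · rintro ⟨d, hd, hdA⟩
    obtain ⟨M, hM, rfl⟩ := mem_image.1 hd
    refine ⟨M, hM, fun i hi => hdA ?_⟩
    exact (mem_support_arcExponent M (i, M i)).2 ⟨hi, rfl⟩
  · rintro ⟨M, hM, hA⟩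
    refine ⟨arcExponent M, mem_image_of_mem _ hM, fun e he => ?_⟩
    obtain ⟨h1, h2⟩ := (mem_support_arcExponent M e).1 he
    have : e = (e.1, M e.1) := Prod.ext rfl h2.symm
    rw [this]
    exact hA e.1 h1

/-- **The Boolean function of the `circuitSizeOver` form of stub A**, evaluated at an arc vector
`x : σ n → Bool`: `true` iff some nest-free perfect matching `M` of `[2n]` has `x (i, M i) = true`
for all `i < M i`. [folklore] -/
theorem nfpmExists_eq_true_iff (n : ℕ) (x : σ n → Bool) :
    decide (SuppFn (NN n) (univ.filter fun e => x e = true)) = true ↔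
      ∃ M ∈ nestFreeMatchings (2 * n), ∀ i, i < M i → x (i, M i) = true := by
  rw [decide_eq_true_iff, suppFn_NN_iff]
  simp only [mem_filter, mem_univ, true_and]

/-- The arc vector of a nest-free perfect matching is accepted (the natural positive test inputs of
an approximation-method argument). [folklore] -/
theorem nfpmExists_arcs (n : ℕ) {M : Fin (2 * n) → Fin (2 * n)}
    (hM : M ∈ nestFreeMatchings (2 * n)) :
    decide (SuppFn (NN n) (univ.filter fun e : σ n =>
      decide (e.1 < M e.1 ∧ M e.1 = e.2) = true)) = true := by
  rw [nfpmExists_eq_true_iff]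
  exact ⟨M, hM, fun i hi => decide_eq_true ⟨hi, rfl⟩⟩

/-- The Boolean function is monotone in the arc vector. [folklore] -/
theorem nfpmExists_monotone (n : ℕ) :
    Monotone (fun x : σ n → Bool => decide (SuppFn (NN n) (univ.filter fun e => x e = true))) := by
  intro x y hxy
  apply Bool.le_iff_imp.2
  intro hx
  rw [nfpmExists_eq_true_iff] at hx ⊢
  obtain ⟨M, hM, hMx⟩ := hx
  exact ⟨M, hM, fun i hi => Bool.eq_true_of_true_le (hMx i hi ▸ hxy (i, M i))⟩

end Summit.ValiantsHypothesis.ValiantsHypothesis.Theorems.FifoMatching.NNNotVP.DivisionSplit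

end
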